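import Literature.MathematicalPhysics.QuantumFieldTheory.Balaban1983to89.T4HistoryLipschitzSegment
import Literature.Analysis.Distribution.ExpLinearEstimates

/-!
# NE9OuterResponseOneTable — the ACTIVITY-LEVEL ONE-TABLE FINITE-DIFFERENCE LEMMA for (2.14)-form activities
(crew item F-P3-2 of road P3, `t4/skeletons/NE9-t4-ne9-p3.md` §4 / leaf row L5d «OUTER RESPONSE, one-table form»; merged crew of
`t4/T4-NE9-TRIGGER.json`; cell `pub-balaban`, T4-DAG §2 node U3 / §6 NE9; seat `b2b-balaban-t4-ne9-formalise-leaf-06`, gen 1)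

HONEST FRAMING (T4-DAG PAGE 1).  Rung (B)+1 on a FIXED finite torus with `FlowStep.BetaPertH` and (B) explicit — NOT infinite
volume, NOT a mass gap, NOT the Clay problem.  NE9 is a cell NEW ESTIMATE, NOT PRINTED, NOT discharged here.  This module is
`[folklore]` analysis (mean-value inequality for the complex exponential, Bochner integration, dominated differentiation) over
the ABSTRACT (2.14)-form activities `Q ↦ ∫ pre(ω)·exp(ℓ_ω Q) dμ(ω)` of `T4HistoryLipschitzActivity` §7 (`ClusterGeom.avgExpLinearAct`);
no Prop-valued definition (trigger c3), no END face re-wired, nothing about Bałaban's objects asserted.  [II] =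
[Balaban1988RG2Cluster] is quoted for TYPES only (ABSOLUTE RULE).  BetaPertH, (B), (B^μ) do not occur.

WHY (road P3, row L5d, with its v1.1 correction kept).  The sibling `T4HistoryLipschitzSegment` §2 bounds the difference of a
(2.14)-form activity at two tables through an exponent ENVELOPE `Re ℓ_ω(·) ≤ e(ω)` valid at BOTH tables (box reading of
(2.15)–(2.20), `norm_integral_const_mul_cexp_sub_le`).  Road P3 reads the outer response AT THE ONE ACTUAL TABLE `Q`: by
`e^{z} − e^{w} = e^{w}(e^{z−w} − 1)` and `‖e^{u} − 1‖ ≤ ‖u‖·e^{max(Re u, 0)}`,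
  `‖ρ[Q + W] − ρ[Q]‖ ≤ (sup ‖ℓ_ω W‖)·e^{sup max(Re ℓ_ω W, 0)}·∫ ‖pre‖·e^{Re ℓ_ω Q} dμ`,
the sups running only over the SUPPORT OF THE PREFACTOR (print's cut-off functions χ_{k,Y₀}χ^c_{k,P} of (2.14) sit inside `pre`:
«sup on the cut-off set»), with NO envelope at `Q + W`.  STANDING (P3 v1.1): under print's envelope majorant the one-table form
REPRODUCES P2's box clause up to a factor `e^{l̄D}` (§4) — CONVENIENCE, NOT STRENGTH; no wall moves (L11/(A″), (R-1) stand).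
What it adds: the perturbed table needs no admissibility, and the FIRST-ORDER response / DERIVATIVE along the pencil
`t ↦ Q + t•W` IS the INSERTION `∫ pre·ℓ_ω W·e^{ℓ_ω Q} dμ` (§2, §5) — the activity-level form of road P3's «derivative =
step-measure insertion» reading (its BIRTH suppliers `NE9BirthInsertion` / `NE9DerivativeTransport` are not touched).

WHAT IS PROVED (kernel, `[folklore]`).  §1 one exponential: identity `const_mul_cexp_add_sub`, one-table bound
`norm_const_mul_cexp_add_sub_le` and its lettered form `…_of_le` (letters needed only where the prefactor is non-zero),
first-order remainder `norm_const_mul_cexp_add_sub_sub_le(_of_le)`, insertion integrand `norm_const_mul_cexp_mul_le_of_le`.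
§2 averaged: integrability at the perturbed table from the one table (`integrable_const_mul_cexp_add_of_support`), THE
ONE-TABLE FINITE-DIFFERENCE BOUND `norm_integral_const_mul_cexp_add_sub_le` (shift form) / `…_sub_le_oneTable` (two tables),
insertion bound `norm_integral_insertion_le`, first-order response `norm_integral_response_sub_insertion_le`.  §3 the same
for `ClusterGeom.avgExpLinearAct`.  §4 COMPARISON `norm_integral_const_mul_cexp_sub_le_box_of_oneTable` (envelope at `Q` ONLY,
`‖ℓ_ω‖ ≤ l̄`, `‖Q′ − Q‖ ≤ D` ⇒ P2's box shape with constant `l̄·e^{l̄D}·∫‖pre‖e^{e}`).  §5 `hasDerivAt_integral_const_mul_cexp_pencil`: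
the complex pencil `t ↦ ρ[Q + t•W]` has derivative the insertion at every `t₀` (Mathlib
`hasDerivAt_integral_of_dominated_loc_of_deriv_le`), `…_pencil_zero` at `t₀ = 0`.
DISGUISE TEST.  One step, one background, one polymer activity, one table and one perturbation; no coupling pair, no
history, no renormalised term — a regularity property of the (2.14) FORM in its input potentials; not NE9.

References (TYPES only): [Balaban1988RG2Cluster] T. Bałaban, Renormalization group approach to lattice gauge field theories
II, CMP 116 (1988): (2.14)–(2.15) p. 15, (2.18)–(2.20) p. 16, (2.23)–(2.26) p. 17.  Tree: `Literature.Analysis.Distribution.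
norm_cexp_sub_one_le` / `norm_cexp_sub_one_sub_le`; Mathlib: `MeasureTheory.norm_integral_le_of_norm_le`, `integral_sub`,
`integral_const_mul`, `hasDerivAt_integral_of_dominated_loc_of_deriv_le`, `HasDerivAt.cexp`.
-/


noncomputable section

namespace Summit.QuantumFields.BalabanUV.T4Continuum.NE9OuterResponseOneTable

open MeasureTheory Metric
open Literature.MathematicalPhysics.QuantumFieldTheory.Balaban1983to89
open Literature.MathematicalPhysics.QuantumFieldTheory.Balaban1983to89.T4OutputRate
open Literature.MathematicalPhysics.QuantumFieldTheory.Balaban1983to89.T4HistoryLipschitzActivity (ClusterGeom)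
open Literature.MathematicalPhysics.QuantumFieldTheory.Balaban1983to89.T4HistoryLipschitzSegment
open Literature.Analysis.Distribution (norm_cexp_sub_one_le norm_cexp_sub_one_sub_le)

/-! ## §1 One exponential of a continuous linear functional: identity, one-table bound, first-order remainder -/

section Pointwise

variable {Pot : Type*} [NormedAddCommGroup Pot] [NormedSpace ℂ Pot]

/-- The finite-difference identity `c·e^{ℓ(Q+W)} − c·e^{ℓQ} = c·e^{ℓQ}·(e^{ℓW} − 1)` (i.e. `e^{z} − e^{w} = e^{w}(e^{z−w} − 1)`
for a functional LINEAR in the table — the form of the last exponential of [II] (2.14) p. 15). [folklore] -/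
theorem const_mul_cexp_add_sub (c : ℂ) (ℓ : Pot →L[ℂ] ℂ) (Q W : Pot) :
    c * Complex.exp (ℓ (Q + W)) - c * Complex.exp (ℓ Q) = c * Complex.exp (ℓ Q) * (Complex.exp (ℓ W) - 1) := by
  rw [map_add, Complex.exp_add]
  ring

/-- **ONE-TABLE BOUND (pointwise).**  `‖c·e^{ℓ(Q+W)} − c·e^{ℓQ}‖ ≤ ‖c‖·e^{Re ℓQ}·(‖ℓW‖·e^{max(Re ℓW, 0)})` — the majorant
is read AT THE ONE TABLE `Q` (`‖e^{ℓQ}‖ = e^{Re ℓQ}`, the (2.14) → (2.15) step for that table), mean-value inequality on the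
segment `[0, ℓW]` (tree `norm_cexp_sub_one_le`).  No bound on `Re ℓ(Q+W)` is used. [folklore] -/
theorem norm_const_mul_cexp_add_sub_le (c : ℂ) (ℓ : Pot →L[ℂ] ℂ) (Q W : Pot) :
    ‖c * Complex.exp (ℓ (Q + W)) - c * Complex.exp (ℓ Q)‖ ≤
      ‖c‖ * Real.exp (ℓ Q).re * (‖ℓ W‖ * Real.exp (max (ℓ W).re 0)) := by
  rw [const_mul_cexp_add_sub, norm_mul, norm_mul, Complex.norm_exp]
  exact mul_le_mul_of_nonneg_left (norm_cexp_sub_one_le (ℓ W)) (mul_nonneg (norm_nonneg _) (Real.exp_pos _).le)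

/-- **ONE-TABLE BOUND with letters, guarded by the support of the prefactor**: if `‖ℓW‖ ≤ r` and `max(Re ℓW, 0) ≤ ρ` WHENEVER
`c ≠ 0` (print's cut-off characteristic functions sit inside the prefactor: the size of the perturbation is needed only «on the
cut-off set»), then `‖c·e^{ℓ(Q+W)} − c·e^{ℓQ}‖ ≤ ‖c‖·e^{Re ℓQ}·(r·e^{ρ})`. [folklore] -/
theorem norm_const_mul_cexp_add_sub_le_of_le {c : ℂ} {ℓ : Pot →L[ℂ] ℂ} {Q W : Pot} {r ρ : ℝ}
    (hr : c ≠ 0 → ‖ℓ W‖ ≤ r) (hρ : c ≠ 0 → max (ℓ W).re 0 ≤ ρ) :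
    ‖c * Complex.exp (ℓ (Q + W)) - c * Complex.exp (ℓ Q)‖ ≤ ‖c‖ * Real.exp (ℓ Q).re * (r * Real.exp ρ) := by
  by_cases hc : c = 0
  · simp [hc]
  · refine (norm_const_mul_cexp_add_sub_le c ℓ Q W).trans
      (mul_le_mul_of_nonneg_left ?_ (mul_nonneg (norm_nonneg _) (Real.exp_pos _).le))
    exact mul_le_mul (hr hc) (Real.exp_le_exp.2 (hρ hc)) (Real.exp_pos _).le ((norm_nonneg _).trans (hr hc))

/-- The first-order identity: `c·e^{ℓ(Q+W)} − c·e^{ℓQ} − c·e^{ℓQ}·ℓW = c·e^{ℓQ}·(e^{ℓW} − 1 − ℓW)` — the linear term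
`c·e^{ℓQ}·ℓW` is the INSERTION of the perturbation into the one-table integrand. [folklore] -/
theorem const_mul_cexp_add_sub_sub (c : ℂ) (ℓ : Pot →L[ℂ] ℂ) (Q W : Pot) :
    c * Complex.exp (ℓ (Q + W)) - c * Complex.exp (ℓ Q) - c * Complex.exp (ℓ Q) * ℓ W =
      c * Complex.exp (ℓ Q) * (Complex.exp (ℓ W) - 1 - ℓ W) := by
  rw [map_add, Complex.exp_add]
  ring

/-- **FIRST-ORDER RESPONSE (pointwise)**: `‖c·e^{ℓ(Q+W)} − c·e^{ℓQ} − c·e^{ℓQ}·ℓW‖ ≤ ‖c‖·e^{Re ℓQ}·(‖ℓW‖²·e^{max(Re ℓW, 0)})`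
(tree `norm_cexp_sub_one_sub_le`) — the finite difference agrees with the insertion to second order, at the one table. [folklore] -/
theorem norm_const_mul_cexp_add_sub_sub_le (c : ℂ) (ℓ : Pot →L[ℂ] ℂ) (Q W : Pot) :
    ‖c * Complex.exp (ℓ (Q + W)) - c * Complex.exp (ℓ Q) - c * Complex.exp (ℓ Q) * ℓ W‖ ≤
      ‖c‖ * Real.exp (ℓ Q).re * (‖ℓ W‖ ^ 2 * Real.exp (max (ℓ W).re 0)) := by
  rw [const_mul_cexp_add_sub_sub, norm_mul, norm_mul, Complex.norm_exp]
  exact mul_le_mul_of_nonneg_left (norm_cexp_sub_one_sub_le (ℓ W)) (mul_nonneg (norm_nonneg _) (Real.exp_pos _).le)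

/-- Guarded letters for the first-order response: `‖ℓW‖ ≤ r`, `max(Re ℓW,0) ≤ ρ` where `c ≠ 0` give the factor `r²·e^{ρ}`.
[folklore] -/
theorem norm_const_mul_cexp_add_sub_sub_le_of_le {c : ℂ} {ℓ : Pot →L[ℂ] ℂ} {Q W : Pot} {r ρ : ℝ}
    (hr : c ≠ 0 → ‖ℓ W‖ ≤ r) (hρ : c ≠ 0 → max (ℓ W).re 0 ≤ ρ) :
    ‖c * Complex.exp (ℓ (Q + W)) - c * Complex.exp (ℓ Q) - c * Complex.exp (ℓ Q) * ℓ W‖ ≤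
      ‖c‖ * Real.exp (ℓ Q).re * (r ^ 2 * Real.exp ρ) := by
  by_cases hc : c = 0
  · simp [hc]
  · refine (norm_const_mul_cexp_add_sub_sub_le c ℓ Q W).trans
      (mul_le_mul_of_nonneg_left ?_ (mul_nonneg (norm_nonneg _) (Real.exp_pos _).le))
    have h0 : 0 ≤ ‖ℓ W‖ := norm_nonneg _
    exact mul_le_mul (pow_le_pow_left₀ h0 (hr hc) 2) (Real.exp_le_exp.2 (hρ hc)) (Real.exp_pos _).le
      (pow_nonneg (h0.trans (hr hc)) 2)

/-- The insertion integrand is bounded at the one table: `‖c·e^{ℓQ}·ℓW‖ ≤ ‖c‖·e^{Re ℓQ}·r` when `‖ℓW‖ ≤ r` where `c ≠ 0`.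
[folklore] -/
theorem norm_const_mul_cexp_mul_le_of_le {c : ℂ} {ℓ : Pot →L[ℂ] ℂ} {Q W : Pot} {r : ℝ} (hr : c ≠ 0 → ‖ℓ W‖ ≤ r) :
    ‖c * Complex.exp (ℓ Q) * ℓ W‖ ≤ ‖c‖ * Real.exp (ℓ Q).re * r := by
  by_cases hc : c = 0
  · simp [hc]
  · rw [norm_mul, norm_mul, Complex.norm_exp]
    exact mul_le_mul_of_nonneg_left (hr hc) (mul_nonneg (norm_nonneg _) (Real.exp_pos _).le)

end Pointwise

/-! ## §2 Averaged over a parameter measure: the one-table finite-difference bound, the insertion, the first-order response -/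

section Averaged

variable {Pot : Type*} [NormedAddCommGroup Pot] [NormedSpace ℂ Pot] {Ω : Type*} [MeasurableSpace Ω]

/-- **Integrability at the PERTURBED table from the one table**: if `max(Re ℓ_ω W, 0) ≤ ρ` on the support of the prefactor,
the integrand at `Q + W` is dominated by `e^{ρ}·‖pre‖·e^{Re ℓ_ω Q}` — no envelope at `Q + W` is needed. [folklore] -/
theorem integrable_const_mul_cexp_add_of_support {μ : Measure Ω} {pre : Ω → ℂ} {lin : Ω → (Pot →L[ℂ] ℂ)}
    (hpre : AEStronglyMeasurable pre μ) (hlinw : ∀ Q : Pot, AEStronglyMeasurable (fun ω => lin ω Q) μ)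
    {Q W : Pot} {ρ : ℝ} (hρ : ∀ ω, pre ω ≠ 0 → max (lin ω W).re 0 ≤ ρ)
    (hint : Integrable (fun ω => ‖pre ω‖ * Real.exp (lin ω Q).re) μ) :
    Integrable (fun ω => pre ω * Complex.exp (lin ω (Q + W))) μ := by
  refine (hint.const_mul (Real.exp ρ)).mono'
    (hpre.mul (Complex.continuous_exp.comp_aestronglyMeasurable (hlinw (Q + W))))
    (Filter.Eventually.of_forall fun ω => ?_)
  by_cases hc : pre ω = 0
  · simp [hc]
  · rw [norm_mul, Complex.norm_exp, map_add, Complex.add_re, Real.exp_add]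
    have h1 : Real.exp (lin ω W).re ≤ Real.exp ρ := Real.exp_le_exp.2 ((le_max_left _ _).trans (hρ ω hc))
    have h2 : 0 ≤ ‖pre ω‖ * Real.exp (lin ω Q).re := mul_nonneg (norm_nonneg _) (Real.exp_pos _).le
    calc ‖pre ω‖ * (Real.exp (lin ω Q).re * Real.exp (lin ω W).re)
        = ‖pre ω‖ * Real.exp (lin ω Q).re * Real.exp (lin ω W).re := by ring
      _ ≤ ‖pre ω‖ * Real.exp (lin ω Q).re * Real.exp ρ := mul_le_mul_of_nonneg_left h1 h2
      _ = Real.exp ρ * (‖pre ω‖ * Real.exp (lin ω Q).re) := by ring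

/-- **THE ONE-TABLE FINITE-DIFFERENCE BOUND (averaged, shift form; crew item F-P3-2).**  For a (2.14)-form activity
`ρ[Q] = ∫ pre(ω)·e^{ℓ_ω Q} dμ(ω)` and a perturbation `W` of the table with `‖ℓ_ω W‖ ≤ r` and `max(Re ℓ_ω W, 0) ≤ ρ` on the
support of the prefactor («sup on the cut-off set»):
  `‖ρ[Q + W] − ρ[Q]‖ ≤ r·e^{ρ}·∫ ‖pre‖·e^{Re ℓ_ω Q} dμ`
— the majorant is print's absolute-value majorant (2.15) FOR THE ONE TABLE `Q`; nothing is assumed at `Q + W`.  Inputs: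
scalar measurability of the functionals, a.e.-strong measurability of the prefactor, integrability of `‖pre‖e^{Re ℓ_ω Q}` (TYPE:
the Gaussian integral (2.23)–(2.25) p. 17 under the smallness of α₅). [folklore] -/
theorem norm_integral_const_mul_cexp_add_sub_le {μ : Measure Ω} {pre : Ω → ℂ} {lin : Ω → (Pot →L[ℂ] ℂ)}
    (hpre : AEStronglyMeasurable pre μ) (hlinw : ∀ Q : Pot, AEStronglyMeasurable (fun ω => lin ω Q) μ)
    {Q W : Pot} {r ρ : ℝ} (hr : ∀ ω, pre ω ≠ 0 → ‖lin ω W‖ ≤ r) (hρ : ∀ ω, pre ω ≠ 0 → max (lin ω W).re 0 ≤ ρ)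
    (hint : Integrable (fun ω => ‖pre ω‖ * Real.exp (lin ω Q).re) μ) :
    ‖(∫ ω, pre ω * Complex.exp (lin ω (Q + W)) ∂μ) - ∫ ω, pre ω * Complex.exp (lin ω Q) ∂μ‖ ≤
      r * Real.exp ρ * ∫ ω, ‖pre ω‖ * Real.exp (lin ω Q).re ∂μ := by
  rw [← integral_sub (integrable_const_mul_cexp_add_of_support hpre hlinw hρ hint)
    (integrable_const_mul_cexp_of_re_le hpre (hlinw Q) hint fun _ => le_rfl), ← integral_const_mul]
  refine norm_integral_le_of_norm_le (hint.const_mul _) (Filter.Eventually.of_forall fun ω => ?_)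
  calc ‖pre ω * Complex.exp (lin ω (Q + W)) - pre ω * Complex.exp (lin ω Q)‖
      ≤ ‖pre ω‖ * Real.exp (lin ω Q).re * (r * Real.exp ρ) := norm_const_mul_cexp_add_sub_le_of_le (hr ω) (hρ ω)
    _ = r * Real.exp ρ * (‖pre ω‖ * Real.exp (lin ω Q).re) := by ring

/-- **THE ONE-TABLE FINITE-DIFFERENCE BOUND, two-table form**: for tables `Q, Q′` with `‖ℓ_ω(Q′ − Q)‖ ≤ r`,
`max(Re ℓ_ω(Q′ − Q), 0) ≤ ρ` on the support of the prefactor, `‖ρ[Q′] − ρ[Q]‖ ≤ r·e^{ρ}·∫ ‖pre‖·e^{Re ℓ_ω Q} dμ` — the second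
table needs NO admissibility / envelope. [folklore] -/
theorem norm_integral_const_mul_cexp_sub_le_oneTable {μ : Measure Ω} {pre : Ω → ℂ} {lin : Ω → (Pot →L[ℂ] ℂ)}
    (hpre : AEStronglyMeasurable pre μ) (hlinw : ∀ Q : Pot, AEStronglyMeasurable (fun ω => lin ω Q) μ)
    {Q Q' : Pot} {r ρ : ℝ} (hr : ∀ ω, pre ω ≠ 0 → ‖lin ω (Q' - Q)‖ ≤ r)
    (hρ : ∀ ω, pre ω ≠ 0 → max (lin ω (Q' - Q)).re 0 ≤ ρ)
    (hint : Integrable (fun ω => ‖pre ω‖ * Real.exp (lin ω Q).re) μ) :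
    ‖(∫ ω, pre ω * Complex.exp (lin ω Q') ∂μ) - ∫ ω, pre ω * Complex.exp (lin ω Q) ∂μ‖ ≤
      r * Real.exp ρ * ∫ ω, ‖pre ω‖ * Real.exp (lin ω Q).re ∂μ := by
  have h := norm_integral_const_mul_cexp_add_sub_le hpre hlinw hr hρ hint
  rwa [add_sub_cancel] at h

/-- Integrability of the INSERTION integrand `pre·e^{ℓ_ω Q}·ℓ_ω W` at the one table, from `‖ℓ_ω W‖ ≤ r` on the support of
the prefactor and integrability of `‖pre‖e^{Re ℓ_ω Q}`. [folklore] -/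
theorem integrable_insertion {μ : Measure Ω} {pre : Ω → ℂ} {lin : Ω → (Pot →L[ℂ] ℂ)}
    (hpre : AEStronglyMeasurable pre μ) (hlinw : ∀ Q : Pot, AEStronglyMeasurable (fun ω => lin ω Q) μ)
    {Q W : Pot} {r : ℝ} (hr : ∀ ω, pre ω ≠ 0 → ‖lin ω W‖ ≤ r)
    (hint : Integrable (fun ω => ‖pre ω‖ * Real.exp (lin ω Q).re) μ) :
    Integrable (fun ω => pre ω * Complex.exp (lin ω Q) * lin ω W) μ := by
  refine (hint.mul_const r).mono'
    ((hpre.mul (Complex.continuous_exp.comp_aestronglyMeasurable (hlinw Q))).mul (hlinw W))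
    (Filter.Eventually.of_forall fun ω => ?_)
  exact norm_const_mul_cexp_mul_le_of_le (hr ω)

/-- **THE INSERTION BOUND at the one table**: `‖∫ pre·e^{ℓ_ω Q}·ℓ_ω W dμ‖ ≤ r·∫ ‖pre‖·e^{Re ℓ_ω Q} dμ` when `‖ℓ_ω W‖ ≤ r` on
the support of the prefactor. [folklore] -/
theorem norm_integral_insertion_le {μ : Measure Ω} {pre : Ω → ℂ} {lin : Ω → (Pot →L[ℂ] ℂ)}
    {Q W : Pot} {r : ℝ} (hr : ∀ ω, pre ω ≠ 0 → ‖lin ω W‖ ≤ r)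
    (hint : Integrable (fun ω => ‖pre ω‖ * Real.exp (lin ω Q).re) μ) :
    ‖∫ ω, pre ω * Complex.exp (lin ω Q) * lin ω W ∂μ‖ ≤ r * ∫ ω, ‖pre ω‖ * Real.exp (lin ω Q).re ∂μ := by
  rw [← integral_const_mul]
  refine norm_integral_le_of_norm_le (hint.const_mul _) (Filter.Eventually.of_forall fun ω => ?_)
  calc ‖pre ω * Complex.exp (lin ω Q) * lin ω W‖ ≤ ‖pre ω‖ * Real.exp (lin ω Q).re * r :=
        norm_const_mul_cexp_mul_le_of_le (hr ω)
    _ = r * (‖pre ω‖ * Real.exp (lin ω Q).re) := by ring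

/-- **THE FIRST-ORDER RESPONSE BOUND (averaged)**: the finite difference minus the insertion is second order in the perturbation,
AT THE ONE TABLE — `‖ρ[Q + W] − ρ[Q] − ∫ pre·e^{ℓ_ω Q}·ℓ_ω W dμ‖ ≤ r²·e^{ρ}·∫ ‖pre‖·e^{Re ℓ_ω Q} dμ` under `‖ℓ_ω W‖ ≤ r`,
`max(Re ℓ_ω W, 0) ≤ ρ` on the support of the prefactor.  (The activity-level form of «derivative of the step = insertion»;
road P3's BIRTH supplier is `NE9BirthInsertion` BY NAME, untouched here.) [folklore] -/
theorem norm_integral_response_sub_insertion_le {μ : Measure Ω} {pre : Ω → ℂ} {lin : Ω → (Pot →L[ℂ] ℂ)}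
    (hpre : AEStronglyMeasurable pre μ) (hlinw : ∀ Q : Pot, AEStronglyMeasurable (fun ω => lin ω Q) μ)
    {Q W : Pot} {r ρ : ℝ} (hr : ∀ ω, pre ω ≠ 0 → ‖lin ω W‖ ≤ r) (hρ : ∀ ω, pre ω ≠ 0 → max (lin ω W).re 0 ≤ ρ)
    (hint : Integrable (fun ω => ‖pre ω‖ * Real.exp (lin ω Q).re) μ) :
    ‖(∫ ω, pre ω * Complex.exp (lin ω (Q + W)) ∂μ) - (∫ ω, pre ω * Complex.exp (lin ω Q) ∂μ) -
        ∫ ω, pre ω * Complex.exp (lin ω Q) * lin ω W ∂μ‖ ≤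
      r ^ 2 * Real.exp ρ * ∫ ω, ‖pre ω‖ * Real.exp (lin ω Q).re ∂μ := by
  have hI1 := integrable_const_mul_cexp_add_of_support hpre hlinw hρ hint
  have hI0 := integrable_const_mul_cexp_of_re_le hpre (hlinw Q) hint fun _ => le_rfl
  have hI2 := integrable_insertion hpre hlinw hr hint
  have hI10 : Integrable (fun ω => pre ω * Complex.exp (lin ω (Q + W)) - pre ω * Complex.exp (lin ω Q)) μ :=
    hI1.sub hI0
  rw [← integral_sub hI1 hI0, ← integral_sub hI10 hI2, ← integral_const_mul]
  refine norm_integral_le_of_norm_le (hint.const_mul _) (Filter.Eventually.of_forall fun ω => ?_)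
  calc ‖pre ω * Complex.exp (lin ω (Q + W)) - pre ω * Complex.exp (lin ω Q) - pre ω * Complex.exp (lin ω Q) * lin ω W‖
      ≤ ‖pre ω‖ * Real.exp (lin ω Q).re * (r ^ 2 * Real.exp ρ) :=
        norm_const_mul_cexp_add_sub_sub_le_of_le (hr ω) (hρ ω)
    _ = r ^ 2 * Real.exp ρ * (‖pre ω‖ * Real.exp (lin ω Q).re) := by ring

end Averaged

/-! ## §3 In the vocabulary of the NE9 ENDs: the (2.14)-form activities `ClusterGeom.avgExpLinearAct` -/

section Activities

variable {C : Carriers} (G : ClusterGeom C) {Bg : Type} {Pot : Type*} [NormedAddCommGroup Pot] [NormedSpace ℂ Pot]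
variable {Ω : Type*} [MeasurableSpace Ω]

/-- **ONE-TABLE TWO-POINT BOUND FOR THE (2.14)-FORM ACTIVITIES OF THE NE9 ENDs** (`T4HistoryLipschitzActivity` §7): at step
`k`, coupling `s`, background `U`, polymer `γ`, for tables `Q, Q′` whose difference is seen by the functionals with size `≤ r`
and real part `≤ ρ` on the support of the prefactor,
`‖act Q′ − act Q‖ ≤ r·e^{ρ}·∫ ‖pre k s U γ ω‖·e^{Re ℓ_{k s U γ ω} Q} dμ` — the majorant at the ONE table `Q`.  Compare the
sibling's `twoPointKP_of_avgExpLinear` (envelope at both tables, segment majorant). [folklore] -/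
theorem norm_avgExpLinearAct_sub_le_oneTable {μ : ℕ → ℝ → Bg → G.P → Measure Ω}
    {pre : ℕ → ℝ → Bg → G.P → Ω → ℂ} {lin : ℕ → ℝ → Bg → G.P → Ω → (Pot →L[ℂ] ℂ)}
    {k : ℕ} {s : ℝ} {U : Bg} {γ : G.P} (hpre : AEStronglyMeasurable (pre k s U γ) (μ k s U γ))
    (hlinw : ∀ Q : Pot, AEStronglyMeasurable (fun ω => lin k s U γ ω Q) (μ k s U γ))
    {Q Q' : Pot} {r ρ : ℝ} (hr : ∀ ω, pre k s U γ ω ≠ 0 → ‖lin k s U γ ω (Q' - Q)‖ ≤ r)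
    (hρ : ∀ ω, pre k s U γ ω ≠ 0 → max (lin k s U γ ω (Q' - Q)).re 0 ≤ ρ)
    (hint : Integrable (fun ω => ‖pre k s U γ ω‖ * Real.exp (lin k s U γ ω Q).re) (μ k s U γ)) :
    ‖G.avgExpLinearAct μ pre lin k s U Q' γ - G.avgExpLinearAct μ pre lin k s U Q γ‖ ≤
      r * Real.exp ρ * ∫ ω, ‖pre k s U γ ω‖ * Real.exp (lin k s U γ ω Q).re ∂(μ k s U γ) :=
  norm_integral_const_mul_cexp_sub_le_oneTable hpre hlinw hr hρ hint

end Activities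

/-! ## §4 COMPARISON with the sibling's box clause — CONVENIENCE, NOT STRENGTH (P3 skeleton v1.1 correction) -/

section Comparison

variable {Pot : Type*} [NormedAddCommGroup Pot] [NormedSpace ℂ Pot] {Ω : Type*} [MeasurableSpace Ω]

/-- **UNDER AN ENVELOPE AT THE ONE TABLE the one-table form gives the box two-point SHAPE.**  If `Re ℓ_ω Q ≤ e(ω)` (an exponent
envelope of (2.20)-TYPE at `Q` ONLY), `‖ℓ_ω‖ ≤ l̄` on the support of the prefactor and `‖Q′ − Q‖ ≤ D`, then
`‖ρ[Q′] − ρ[Q]‖ ≤ l̄·e^{l̄·D}·(∫ ‖pre‖·e^{e} dμ)·‖Q′ − Q‖` — the sibling's `norm_integral_const_mul_cexp_sub_le` shape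
(there: envelope at BOTH tables, constant `∫‖pre‖·l·e^{e}`), here with ONE envelope and the extra factor `e^{l̄D}`.  Under print's
(1.36)/(1.42)–(1.43) box both forms have the same standing; this is why F-P3-2 is booked as cosmetic. [folklore] -/
theorem norm_integral_const_mul_cexp_sub_le_box_of_oneTable {μ : Measure Ω} {pre : Ω → ℂ} {lin : Ω → (Pot →L[ℂ] ℂ)}
    {e : Ω → ℝ} {lbar D : ℝ} (hpre : AEStronglyMeasurable pre μ)
    (hlinw : ∀ Q : Pot, AEStronglyMeasurable (fun ω => lin ω Q) μ) (hlbar : 0 ≤ lbar)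
    (hl : ∀ ω, pre ω ≠ 0 → ‖lin ω‖ ≤ lbar) (hint₀ : Integrable (fun ω => ‖pre ω‖ * Real.exp (e ω)) μ) {Q Q' : Pot}
    (hQ : ∀ ω, (lin ω Q).re ≤ e ω) (hD : ‖Q' - Q‖ ≤ D) :
    ‖(∫ ω, pre ω * Complex.exp (lin ω Q') ∂μ) - ∫ ω, pre ω * Complex.exp (lin ω Q) ∂μ‖ ≤
      lbar * Real.exp (lbar * D) * (∫ ω, ‖pre ω‖ * Real.exp (e ω) ∂μ) * ‖Q' - Q‖ := by
  -- the letters of §2 for the perturbation `Q′ − Q`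
  have hr : ∀ ω, pre ω ≠ 0 → ‖lin ω (Q' - Q)‖ ≤ lbar * ‖Q' - Q‖ := fun ω hc =>
    (ContinuousLinearMap.le_opNorm _ _).trans (mul_le_mul_of_nonneg_right (hl ω hc) (norm_nonneg _))
  have hρ : ∀ ω, pre ω ≠ 0 → max (lin ω (Q' - Q)).re 0 ≤ lbar * D := fun ω hc =>
    max_le ((le_abs_self _).trans ((Complex.abs_re_le_norm _).trans
      ((hr ω hc).trans (mul_le_mul_of_nonneg_left hD hlbar)))) (mul_nonneg hlbar ((norm_nonneg _).trans hD))
  -- the one-table majorant under the envelope at `Q`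
  have hle : ∀ ω, ‖pre ω‖ * Real.exp (lin ω Q).re ≤ ‖pre ω‖ * Real.exp (e ω) := fun ω =>
    mul_le_mul_of_nonneg_left (Real.exp_le_exp.2 (hQ ω)) (norm_nonneg _)
  have hint : Integrable (fun ω => ‖pre ω‖ * Real.exp (lin ω Q).re) μ :=
    hint₀.mono' (hpre.norm.mul (Real.continuous_exp.comp_aestronglyMeasurable
      (Complex.continuous_re.comp_aestronglyMeasurable (hlinw Q))))
      (Filter.Eventually.of_forall fun ω => by
        rw [Real.norm_of_nonneg (mul_nonneg (norm_nonneg _) (Real.exp_pos _).le)]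
        exact hle ω)
  calc ‖(∫ ω, pre ω * Complex.exp (lin ω Q') ∂μ) - ∫ ω, pre ω * Complex.exp (lin ω Q) ∂μ‖
      ≤ lbar * ‖Q' - Q‖ * Real.exp (lbar * D) * ∫ ω, ‖pre ω‖ * Real.exp (lin ω Q).re ∂μ :=
        norm_integral_const_mul_cexp_sub_le_oneTable hpre hlinw hr hρ hint
    _ ≤ lbar * ‖Q' - Q‖ * Real.exp (lbar * D) * ∫ ω, ‖pre ω‖ * Real.exp (e ω) ∂μ :=
        mul_le_mul_of_nonneg_left (integral_mono hint hint₀ hle)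
          (mul_nonneg (mul_nonneg hlbar (norm_nonneg _)) (Real.exp_pos _).le)
    _ = lbar * Real.exp (lbar * D) * (∫ ω, ‖pre ω‖ * Real.exp (e ω) ∂μ) * ‖Q' - Q‖ := by ring

end Comparison

/-! ## §5 THE PENCIL `t ↦ ρ[Q + t•W]` IS HOLOMORPHIC WITH DERIVATIVE THE INSERTION (derivative = step-measure insertion, at
the activity level, at the one table) -/

section Pencil

variable {Pot : Type*} [NormedAddCommGroup Pot] [NormedSpace ℂ Pot] {Ω : Type*} [MeasurableSpace Ω]

/-- Along the complex pencil through the one table, the functional is affine in the parameter: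
`ℓ(Q + t•W) = ℓQ + t·ℓW`. [folklore] -/
theorem apply_add_smul (ℓ : Pot →L[ℂ] ℂ) (Q W : Pot) (t : ℂ) : ℓ (Q + t • W) = ℓ Q + t * ℓ W := by
  rw [map_add, map_smul, smul_eq_mul]

/-- The one-exponential integrand along the pencil has derivative «itself times `ℓW`» in the parameter. [folklore] -/
theorem hasDerivAt_const_mul_cexp_pencil (c : ℂ) (ℓ : Pot →L[ℂ] ℂ) (Q W : Pot) (t : ℂ) :
    HasDerivAt (fun t : ℂ => c * Complex.exp (ℓ (Q + t • W))) (c * Complex.exp (ℓ (Q + t • W)) * ℓ W) t := by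
  have h1 : HasDerivAt (fun t : ℂ => ℓ Q + t * ℓ W) (1 * ℓ W) t := ((hasDerivAt_id t).mul_const (ℓ W)).const_add (ℓ Q)
  have h2 := (h1.cexp).const_mul c
  simp only [one_mul] at h2
  have h3 : (fun t : ℂ => c * Complex.exp (ℓ (Q + t • W))) = fun t : ℂ => c * Complex.exp (ℓ Q + t * ℓ W) := by
    funext t; rw [apply_add_smul]
  rw [h3, apply_add_smul]
  rw [← mul_assoc] at h2
  exact h2

/-- **DERIVATIVE = INSERTION (averaged, kernel).**  For a (2.14)-form activity `ρ[Q] = ∫ pre·e^{ℓ_ω Q} dμ` with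
`‖ℓ_ω W‖ ≤ r` on the support of the prefactor and `‖pre‖e^{Re ℓ_ω Q}` integrable, the complex pencil
`t ↦ ρ[Q + t•W]` has at every `t₀` the derivative `∫ pre·e^{ℓ_ω(Q + t₀•W)}·ℓ_ω W dμ` — the INSERTION of the perturbation into
the step measure read at the table `Q + t₀•W` (dominated differentiation under the integral sign on the ball of radius 1 about
`t₀`, dominating function `r·e^{(‖t₀‖+1)r}·‖pre‖e^{Re ℓ_ω Q}`).  No envelope, no admissibility of the perturbed tables. [folklore] -/
theorem hasDerivAt_integral_const_mul_cexp_pencil {μ : Measure Ω} {pre : Ω → ℂ} {lin : Ω → (Pot →L[ℂ] ℂ)}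
    (hpre : AEStronglyMeasurable pre μ) (hlinw : ∀ Q : Pot, AEStronglyMeasurable (fun ω => lin ω Q) μ)
    {Q W : Pot} {r : ℝ} (hr : ∀ ω, pre ω ≠ 0 → ‖lin ω W‖ ≤ r)
    (hint : Integrable (fun ω => ‖pre ω‖ * Real.exp (lin ω Q).re) μ) (t₀ : ℂ) :
    HasDerivAt (fun t : ℂ => ∫ ω, pre ω * Complex.exp (lin ω (Q + t • W)) ∂μ)
      (∫ ω, pre ω * Complex.exp (lin ω (Q + t₀ • W)) * lin ω W ∂μ) t₀ := by
  -- letters along the pencil: the perturbation `t • W` is seen with size `‖t‖·‖ℓ_ω W‖ ≤ ‖t‖·r`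
  have hsize : ∀ (t : ℂ) (ω : Ω), pre ω ≠ 0 → ‖lin ω (t • W)‖ ≤ ‖t‖ * r := fun t ω hc => by
    rw [map_smul, smul_eq_mul, norm_mul]
    exact mul_le_mul_of_nonneg_left (hr ω hc) (norm_nonneg _)
  have hre : ∀ (t : ℂ) (ω : Ω), pre ω ≠ 0 → max (lin ω (t • W)).re 0 ≤ ‖t‖ * r := fun t ω hc =>
    max_le ((le_abs_self _).trans ((Complex.abs_re_le_norm _).trans (hsize t ω hc)))
      (mul_nonneg (norm_nonneg _) ((norm_nonneg _).trans (hr ω hc)))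
  have hmeas : ∀ t : ℂ, AEStronglyMeasurable (fun ω => pre ω * Complex.exp (lin ω (Q + t • W))) μ := fun t =>
    hpre.mul (Complex.continuous_exp.comp_aestronglyMeasurable (hlinw (Q + t • W)))
  have key := hasDerivAt_integral_of_dominated_loc_of_deriv_le (μ := μ) (x₀ := t₀)
    (F := fun (t : ℂ) (ω : Ω) => pre ω * Complex.exp (lin ω (Q + t • W)))
    (F' := fun (t : ℂ) (ω : Ω) => pre ω * Complex.exp (lin ω (Q + t • W)) * lin ω W)
    (bound := fun ω => Real.exp ((‖t₀‖ + 1) * r) * r * (‖pre ω‖ * Real.exp (lin ω Q).re))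
    (ball_mem_nhds t₀ zero_lt_one)
    (Filter.Eventually.of_forall hmeas)
    (integrable_const_mul_cexp_add_of_support hpre hlinw (hre t₀) hint)
    ((hmeas t₀).mul (hlinw W)) ?_ ((hint.const_mul _)) ?_
  · exact key.2
  · -- domination on the ball of radius 1 about t₀
    refine Filter.Eventually.of_forall fun ω t ht => ?_
    by_cases hc : pre ω = 0
    · simp [hc]
    · have hr0 : 0 ≤ r := (norm_nonneg _).trans (hr ω hc)
      have ht1 : ‖t‖ ≤ ‖t₀‖ + 1 := by
        have h := mem_ball_iff_norm.1 ht
        calc ‖t‖ = ‖(t - t₀) + t₀‖ := by rw [sub_add_cancel]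
          _ ≤ ‖t - t₀‖ + ‖t₀‖ := norm_add_le _ _
          _ ≤ ‖t₀‖ + 1 := by linarith
      rw [norm_mul, norm_mul, Complex.norm_exp, map_add, Complex.add_re, Real.exp_add]
      have h1 : Real.exp (lin ω (t • W)).re ≤ Real.exp ((‖t₀‖ + 1) * r) :=
        Real.exp_le_exp.2 (((le_max_left _ _).trans (hre t ω hc)).trans (mul_le_mul_of_nonneg_right ht1 hr0))
      have h2 : 0 ≤ ‖pre ω‖ * Real.exp (lin ω Q).re := mul_nonneg (norm_nonneg _) (Real.exp_pos _).le
      calc ‖pre ω‖ * (Real.exp (lin ω Q).re * Real.exp (lin ω (t • W)).re) * ‖lin ω W‖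
          = (Real.exp (lin ω (t • W)).re * ‖lin ω W‖) * (‖pre ω‖ * Real.exp (lin ω Q).re) := by ring
        _ ≤ (Real.exp ((‖t₀‖ + 1) * r) * r) * (‖pre ω‖ * Real.exp (lin ω Q).re) :=
          mul_le_mul_of_nonneg_right (mul_le_mul h1 (hr ω hc) (norm_nonneg _) (Real.exp_pos _).le) h2
  · exact Filter.Eventually.of_forall fun ω t _ => hasDerivAt_const_mul_cexp_pencil (pre ω) (lin ω) Q W t

/-- **At `t₀ = 0`: the derivative of the pencil at the one table IS the insertion `∫ pre·e^{ℓ_ω Q}·ℓ_ω W dμ`** (whose size is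
bounded by `norm_integral_insertion_le`, and which the finite difference approximates to second order by
`norm_integral_response_sub_insertion_le`). [folklore] -/
theorem hasDerivAt_integral_const_mul_cexp_pencil_zero {μ : Measure Ω} {pre : Ω → ℂ} {lin : Ω → (Pot →L[ℂ] ℂ)}
    (hpre : AEStronglyMeasurable pre μ) (hlinw : ∀ Q : Pot, AEStronglyMeasurable (fun ω => lin ω Q) μ)
    {Q W : Pot} {r : ℝ} (hr : ∀ ω, pre ω ≠ 0 → ‖lin ω W‖ ≤ r)
    (hint : Integrable (fun ω => ‖pre ω‖ * Real.exp (lin ω Q).re) μ) :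
    HasDerivAt (fun t : ℂ => ∫ ω, pre ω * Complex.exp (lin ω (Q + t • W)) ∂μ)
      (∫ ω, pre ω * Complex.exp (lin ω Q) * lin ω W ∂μ) 0 := by
  have h := hasDerivAt_integral_const_mul_cexp_pencil hpre hlinw hr hint 0
  simpa only [zero_smul, add_zero] using h

end Pencil

end Summit.QuantumFields.BalabanUV.T4Continuum.NE9OuterResponseOneTable

end
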